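import Summits.CriticalPhenomena.SAWScalingLimit.Theses.SAWRenewalTightness
import Literature.Probability.RandomPlanarGeometry.SLELawOfDrivingProcessLocal
import Literature.Probability.RandomPlanarGeometry.SLETwoPointMartingale

/-!
# Sketch (crux-ideate, ideator 2) — first lemmas for the crux ideas on
`SubseqIdentification` (stmt-CriticalPhenomena-0783)

* `touchObs`, `SquaredCauchyCharacterisesSLE` — card `brownian-touch-squared-cauchy`:
  the continuum endgame "the squared Cauchy kernel g_t'(x)²/(g_t(x)-W_t)² is a martingale for all
  real x ⇒ κ = 8/3" (far-field expansion 1 + 2W/x + (3W² - 8t)/x²).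
* `rwExcMass`, `TouchKernelRatio` — the lattice crux of that card: boundary-touch probability of
  the critical SAW from the tip = b · (random-walk excursion touch probability), uniformly.
* `BoundaryAreaLaw` — card `boundary-area-law`: subsequential limits hit small boundary balls at
  flat boundary points with probability ≍ r².
-/

noncomputable section

open scoped NNReal ENNReal Topology Classical
open MeasureTheory Filter Set

namespace Summit.CriticalPhenomena.SAWScalingLimit.Cruxes.SubseqIdentification.Ideator2

open Literature.Probability.RandomPlanarGeometry Literature.Probability.LatticeModels

/-- The **squared-Cauchy (boundary-touch) observable** of a driving function `W` at the real
point `x`: `g_t'(x)² / (g_t(x) - W_t)²`, written through the real Loewner flow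
`X_t = Re g_t(x) - W_t` (`Loewner.realFlow`) and `g_t'(x) = exp(-∫₀ᵗ 2/X_s² ds)`, and FROZEN at
the first time `|X|` drops to `1` (so that for `|x| ≥ 2` it is a bounded continuous functional,
meaningful before any swallowing). -/
def touchObs (W : ℝ≥0 → ℝ) (x : ℝ) (t : ℝ≥0) : ℝ :=
  let X : ℝ≥0 → ℝ := Loewner.realFlow W x
  let τ : ℝ≥0 :=
    if (∃ u : ℝ≥0, u ≤ t ∧ |X u| ≤ 1) then sInf {u : ℝ≥0 | u ≤ t ∧ |X u| ≤ 1} else t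
  Real.exp (-2 * ∫ s in (0 : ℝ)..(τ : ℝ), 2 / (X s.toNNReal) ^ 2) / (X τ) ^ 2

/-- **The squared Cauchy kernel characterises SLE(8/3)** (continuum first lemma of card
`brownian-touch-squared-cauchy`; analogue of `SchrammCharacterisesSLE` of route
SAWSchrammPassage): if a probability law `ν` on curve classes in `(D; a, b)` is a.e. driven through a
chordal uniformizer `φ` by a continuous adapted process `W` with `W₀ = 0`, and for every real point
`x` with `|x| ≥ 2` the frozen squared-Cauchy observable `t ↦ g_t'(x)²/(g_t(x)-W_t)²` is an
`𝓕`-martingale, then `ν` is the chordal SLE_{8/3} law. Mechanism: far-field expansion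
`x² · touchObs = 1 + 2W_t/x + (3W_t² - 8t)/x² + O(x⁻³)` makes `W` and `W² - (8/3)t` local
martingales; Lévy + `isSLELaw_of_isLocalMartingale_driving_of_lt_four` (PROVED, κ = 8/3 < 4). -/
def SquaredCauchyCharacterisesSLE : Prop :=
  ∀ (D : DobrushinDomain) (φ : ConformalEquiv UpperHalfPlane.upperHalfPlaneSet D.carrier),
    D.IsChordalUniformizing φ →
    ∀ (ν : Measure (CurveClass ℂ)), IsProbabilityMeasure ν →
    ∀ (W : CurveClass ℂ → ℝ≥0 → ℝ), (∀ t, Measurable fun c => W c t) →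
      (∀ᵐ c ∂ν, W c 0 = 0) → (∀ᵐ c ∂ν, Continuous (W c)) →
      (∀ᵐ c ∂ν, Loewner.IsDrivenBy φ.boundaryExtension (D.pt 1) (W c) c) →
    ∀ (𝓕 : Filtration ℝ≥0 (inferInstance : MeasurableSpace (CurveClass ℂ))),
      MeasureTheory.Adapted 𝓕 (fun t c => W c t) →
      (∀ x : ℝ, 2 ≤ |x| → MeasureTheory.Martingale (fun t c => touchObs (W c) x t) 𝓕 ν) →
    IsSLELaw ((8 : ℝ≥0) / 3) D ν

/-- Mass, under the simple-random-walk weight `4^{-|ω|}`, of the nearest-neighbour walks of `Ω_δ`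
from `z` to `w` that avoid the vertex set `F` after time `0`, hit `w` only at their last step, and
visit the vertex set `E` — the lattice **random-walk excursion** (Poisson-kernel) mass of the slit
graph with a visiting constraint. Cross-multiplied use only (no normalisation inside). -/
def rwExcMass (Ω : Set ℂ) (δ : ℝ) (z w : Site 2) (F E : Set (Site 2)) : ℝ≥0∞ :=
  ∑' ω : (discreteDomainGraph Ω δ).Walk z w,
    Set.indicator {ω' | (∀ v ∈ ω'.support.tail, v ∉ F) ∧ ω'.support.count w = 1 ∧
        ∃ v ∈ ω'.support, v ∈ E}
      (fun ω' => (4 : ℝ≥0∞)⁻¹ ^ ω'.length) ω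

/-- **Touch-kernel ratio (lattice crux of card `brownian-touch-squared-cauchy`)**: there is ONE
constant `b > 0` (a posteriori `b = 5/8`) such that for every Dobrushin domain, endpoint
approximation, boundary point `x ∉ {a, b}`, tolerance `ε` and separation `ρ`, for all small radii
`r` and then all small meshes `δ`, UNIFORMLY over self-avoiding pasts `η` from `a_δ` to a tip `z`
staying `ρ`-away from `x`, without necks at scale `ρ` (tolerance `θ`) and with boundary clearance
`θρ` away from the start: the probability that the critical SAW continued from the tip (exact
domain-Markov: the SAW law of the slit domain `Ω ∖ η` from `z` to `b_δ`) visits the `r`-ball at `x`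
is within a factor `b ± ε` of the probability that the random-walk excursion of the same slit
graph from `z` to `b_δ` does (both sides cross-multiplied: SAW side as the law of `Ω_δ` from the tip conditioned
to avoid the past, RW side as `4^{-n}`-masses). "Where — and how often — the polymer touches the wall is Brownian,
up to one universal constant." -/
def TouchKernelRatio : Prop :=
  ∃ b : ℝ, 0 < b ∧
    ∀ (D : DobrushinDomain) (a w : ℝ → Site 2), SAW.IsEndpointApprox D a w →
    ∀ x ∈ frontier D.carrier, x ≠ D.pt 0 → x ≠ D.pt 1 →
    ∀ ε : ℝ, 0 < ε → ∀ ρ : ℝ, 0 < ρ → ∀ θ : ℝ, 0 < θ →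
    ∃ r₀ : ℝ, 0 < r₀ ∧ ∀ r ∈ Ioo (0 : ℝ) r₀, ∀ᶠ δ in 𝓝[>] (0 : ℝ),
      ∀ (z : Site 2) (η : (discreteDomainGraph D.carrier δ).Walk (a δ) z), η.IsPath →
        -- the past stays `ρ`-away from the boundary point `x`
        (∀ v ∈ η.support, ρ ≤ dist (meshPoint δ v) x) →
        -- no necks at scale `ρ`: two points of the past within `θρ` are joined by a sub-arc of
        -- diameter `≤ ρ` (excludes one-site gates far from `x`, where lattice parity kills the SAW
        -- but not the random walk)
        (∀ i j : ℕ, i ≤ j → j ≤ η.length →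
          dist (meshPoint δ (η.getVert i)) (meshPoint δ (η.getVert j)) ≤ θ * ρ →
            ∀ k : ℕ, i ≤ k → k ≤ j →
              dist (meshPoint δ (η.getVert k)) (meshPoint δ (η.getVert i)) ≤ ρ) →
        -- boundary clearance `θρ` away from the starting point
        (∀ v ∈ η.support, ρ ≤ dist (meshPoint δ v) (meshPoint δ (a δ)) →
          θ * ρ ≤ Metric.infDist (meshPoint δ v) (frontier D.carrier)) →
        let F : Set (Site 2) := {v | v ∈ η.support ∧ v ≠ z}
        let E : Set (Site 2) := {v | dist (meshPoint δ v) x < r}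
        -- future of the SAW given the past `η` = critical SAW of `Ω_δ` from the tip `z` to `b_δ`
        -- CONDITIONED to avoid the past (exact domain-Markov + restriction; written cross-multiplied,
        -- inside the original discrete domain, so no slit-carrier / largest-component artefact)
        let qAvoid : ℝ≥0∞ := SAW.law D.carrier δ z (w δ) {γ | ∀ v ∈ γ.walk.support.tail, v ∉ F}
        let qTouch : ℝ≥0∞ :=
          SAW.law D.carrier δ z (w δ) {γ | (∀ v ∈ γ.walk.support.tail, v ∉ F) ∧ ∃ v ∈ γ.walk.support, v ∈ E}
        qTouch * rwExcMass D.carrier δ z (w δ) F Set.univ ≤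
            ENNReal.ofReal (b + ε) * rwExcMass D.carrier δ z (w δ) F E * qAvoid ∧
          ENNReal.ofReal (b - ε) * rwExcMass D.carrier δ z (w δ) F E * qAvoid ≤
            qTouch * rwExcMass D.carrier δ z (w δ) F Set.univ

/-- **Boundary area law (card `boundary-area-law`)**: every subsequential weak limit `μ` of the
critical SAW laws (exactly the hypotheses of the crux `SubseqIdentification`) hits small balls at a
LOCALLY FLAT boundary point `x ∉ {a, b}` with probability comparable to `r²` — boundary-touch
exponent exactly `2` (the value `8/κ - 1 = 2` singles out `κ = 8/3` among SLE_κ). -/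
def BoundaryAreaLaw : Prop :=
  ∀ (D : DobrushinDomain) (a b : ℝ → Site 2), SAW.IsEndpointApprox D a b →
    ∀ (s : ℕ → ℝ) (μ : Measure (CurveClass ℂ)), Tendsto s atTop (𝓝[>] (0 : ℝ)) →
      IsProbabilityMeasure μ →
      (∀ f : BoundedContinuousFunction (CurveClass ℂ) ℝ,
        Tendsto (fun n => ∫ γ, f γ.curve ∂(SAW.law D.carrier (s n) (a (s n)) (b (s n))))
          atTop (𝓝 (∫ c, f c ∂μ))) →
      ∀ x ∈ frontier D.carrier, x ≠ D.pt 0 → x ≠ D.pt 1 →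
        (∃ (ρ₀ : ℝ) (u : ℂ), 0 < ρ₀ ∧ ‖u‖ = 1 ∧
          D.carrier ∩ Metric.ball x ρ₀ = {y | 0 < (starRingEnd ℂ u * (y - x)).im} ∩ Metric.ball x ρ₀) →
        ∃ c C r₀ : ℝ, 0 < c ∧ 0 < r₀ ∧ ∀ r ∈ Ioo (0 : ℝ) r₀,
          ENNReal.ofReal (c * r ^ 2) ≤ μ {γ | (γ.range ∩ Metric.ball x r).Nonempty} ∧
            μ {γ | (γ.range ∩ Metric.ball x r).Nonempty} ≤ ENNReal.ofReal (C * r ^ 2)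

end Summit.CriticalPhenomena.SAWScalingLimit.Cruxes.SubseqIdentification.Ideator2
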